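import Summits.RiemannHypothesis.RiemannHypothesis.Theorems.SoloInformedQuasiWeilCriterion
import Literature.NumberTheory.LFunctions.WeilWindowSuzukiContinuityProofs
import Literature.NumberTheory.LFunctions.WeilGroundEnergyParitySplit
import Literature.NumberTheory.LFunctions.WeilGroundEnergyProofs
import Literature.NumberTheory.LFunctions.WeilFirstPrimePositivityC
import Literature.NumberTheory.LFunctions.UniformWeilPositivityRH
import Literature.NumberTheory.LFunctions.WeilSemilocalCompactness
import HarnessLib

/-!
# The onset window of a hypothetical counterexample (solo-informed T56)

Write `ε(a) = weilGroundEnergy a` for the ground energy of the Weil form on the window `[-a, a]`.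
The tree knows: `ε` is antitone on `(0, ∞)` (`weilGroundEnergy_anti`), continuous at every `a₀ > 0`
(`continuousAt_weilGroundEnergy`, Suzuki 2026 Thm 1.3), non-negative on `(0, (log 3)/2]`
(`weilPositivityOn_log_three_half` + `weilGroundEnergy_nonneg_iff_holds`), non-negative everywhere
iff RH (`riemannHypothesis_iff_forall_weilPositivityOn`), and negative for arbitrarily large `a` if RH
fails (`exists_frequently_weilGroundEnergy_lt_of_not_riemannHypothesis`, T6).

Putting these together by the intermediate value property of a continuous antitone function:

* `not_riemannHypothesis_iff_exists_isWeilOnset` — RH fails iff there is an ONSET WINDOW `a₀`: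
  `ε ≥ 0` on `(0, a₀)`, `ε(a₀) = 0` exactly, and `ε < 0` on `(a₀, ∞)`; the onset is unique
  (`IsWeilOnset.unique`) and at least `(log 3)/2` (`IsWeilOnset.log_three_half_le`; more generally
  every certified positivity window lies below it, `IsWeilOnset.le_of_weilPositivityOn`).
* `weilGroundEnergy_sign_dichotomy` — the sign pattern of `ε` on `(0, ∞)` is either `≥ 0` throughout
  (RH) or `≥ 0 | = 0 | < 0` with a single sign change (not RH); nothing else can occur.
* `riemannHypothesis_iff_zero_energy_absorbing` — RH iff the value `0` of `ε` is absorbing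
  (`ε(a) = 0 → ε(b) = 0` for all `b > a`).
* `exists_zero_energy_groundState_of_not_riemannHypothesis` — under the compactness fact
  `ConnesConsaniMoscovici2025_thm_3_6` (hypothesis), a counterexample to RH carries, on its onset window,
  an `L²`-normalised ground state of energy exactly `0` of a positive semi-definite window form: a
  degenerate semi-definite window.

No new analytic input; the content is the exact-zero window (the tree's criterion
`riemannHypothesis_iff_forall_weilPositivityOn` only speaks of the sign of `ε`).

References: E. Bombieri, Rend. Mat. Acc. Lincei (9) 11 (2000) §4–§5 (key `Bombieri2000Weil`);
M. Suzuki, arXiv:2606.09096 (2026) Thm 1.3 (key `Suzuki2026`); H. Yoshida, Duke Math. J. 63 (1992)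
Thm 1 (key `Yoshida1992`); A. Connes, C. Consani, H. Moscovici, arXiv:2511.22755 Thm 3.6
(key `ConnesConsaniMoscovici2025`).
-/

noncomputable section

open Filter Set Topology
open Literature.NumberTheory.LFunctions

namespace Summit.RiemannHypothesis.RiemannHypothesis.Theorems

/-- **Onset window.** `IsWeilOnset a₀`: `a₀ > 0`, the ground energy is non-negative on `(0, a₀)`,
vanishes exactly at `a₀`, and is negative on `(a₀, ∞)`. [new] -/
def IsWeilOnset (a₀ : ℝ) : Prop :=
  0 < a₀ ∧ weilGroundEnergy a₀ = 0 ∧ (∀ a, 0 < a → a < a₀ → 0 ≤ weilGroundEnergy a) ∧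
    ∀ a, a₀ < a → weilGroundEnergy a < 0

/-- `ε ≥ 0` on every certified positivity window. [folklore] -/
theorem weilGroundEnergy_nonneg_of_weilPositivityOn {a b : ℝ} (ha : 0 < a) (hab : a ≤ b)
    (hb : WeilPositivityOn b) : 0 ≤ weilGroundEnergy a :=
  (weilGroundEnergy_nonneg_iff_holds ha).2 (hb.mono hab)

/-- `ε ≥ 0` on `(0, (log 3)/2]` (first-prime positivity, in the tree). [cite: Yoshida1992, Thm 1] -/
theorem weilGroundEnergy_nonneg_of_le_log_three_half {a : ℝ} (ha : 0 < a)
    (h : a ≤ Real.log 3 / 2) : 0 ≤ weilGroundEnergy a :=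
  weilGroundEnergy_nonneg_of_weilPositivityOn ha h weilPositivityOn_log_three_half

/-- If RH fails, `ε` is negative on some window beyond `(log 3)/2`. [folklore] -/
theorem exists_weilGroundEnergy_neg_of_not_riemannHypothesis (h : ¬ RiemannHypothesis) :
    ∃ a : ℝ, Real.log 3 / 2 < a ∧ weilGroundEnergy a < 0 := by
  obtain ⟨κ, -, hκ⟩ := exists_frequently_weilGroundEnergy_lt_of_not_riemannHypothesis h
  have hfr := hκ 0
  rw [Filter.frequently_atTop] at hfr
  obtain ⟨a, ha, hlt⟩ := hfr (Real.log 3 / 2 + 1)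
  exact ⟨a, by linarith, by simpa using hlt⟩

namespace IsWeilOnset

variable {a₀ a₁ : ℝ}

/-- The onset is positive. [new] -/
theorem pos (h : IsWeilOnset a₀) : 0 < a₀ := h.1

/-- The ground energy vanishes at the onset. [new] -/
theorem eq_zero (h : IsWeilOnset a₀) : weilGroundEnergy a₀ = 0 := h.2.1

/-- `ε ≥ 0` on `(0, a₀]`. [new] -/
theorem nonneg (h : IsWeilOnset a₀) {a : ℝ} (ha : 0 < a) (hle : a ≤ a₀) :
    0 ≤ weilGroundEnergy a := by
  rcases hle.lt_or_eq with hlt | rfl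
  · exact h.2.2.1 a ha hlt
  · exact h.2.1.ge

/-- `ε < 0` beyond the onset. [new] -/
theorem neg (h : IsWeilOnset a₀) {a : ℝ} (ha : a₀ < a) : weilGroundEnergy a < 0 := h.2.2.2 a ha

/-- Every certified positivity window lies below the onset. [new] -/
theorem le_of_weilPositivityOn (h : IsWeilOnset a₀) {b : ℝ} (hb : WeilPositivityOn b) : b ≤ a₀ := by
  by_contra hlt
  push Not at hlt
  exact absurd (weilGroundEnergy_nonneg_of_weilPositivityOn (h.pos.trans hlt) le_rfl hb) (not_le.2 (h.neg hlt))

/-- In particular the onset is at least `(log 3)/2`. [new] -/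
theorem log_three_half_le (h : IsWeilOnset a₀) : Real.log 3 / 2 ≤ a₀ :=
  h.le_of_weilPositivityOn weilPositivityOn_log_three_half

/-- The onset is unique. [new] -/
theorem unique (h₀ : IsWeilOnset a₀) (h₁ : IsWeilOnset a₁) : a₀ = a₁ := by
  rcases lt_trichotomy a₀ a₁ with hlt | heq | hgt
  · exact absurd h₁.eq_zero (h₀.neg hlt).ne
  · exact heq
  · exact absurd h₀.eq_zero (h₁.neg hgt).ne

/-- An onset refutes RH. [new] -/
theorem not_riemannHypothesis (h : IsWeilOnset a₀) : ¬ RiemannHypothesis := fun hRH ↦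
  absurd (weilGroundEnergy_nonneg_of_riemannHypothesis hRH (h.pos.trans (lt_add_one a₀)))
    (not_le.2 (h.neg (lt_add_one a₀)))

/-- Beyond the onset Weil positivity fails on every window. [new] -/
theorem not_weilPositivityOn (h : IsWeilOnset a₀) {a : ℝ} (ha : a₀ < a) : ¬ WeilPositivityOn a :=
  fun hW ↦ absurd ha (not_lt.2 (h.le_of_weilPositivityOn hW))

end IsWeilOnset

/-- **Existence of the onset window if RH fails**: `a₀ := inf {a > 0 : ε(a) < 0}`; antitonicity
makes `ε < 0` on `(a₀, ∞)`, minimality makes `ε ≥ 0` on `(0, a₀)`, and continuity at `a₀ > 0` pins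
`ε(a₀) = 0`. [new] -/
theorem exists_isWeilOnset_of_not_riemannHypothesis (h : ¬ RiemannHypothesis) :
    ∃ a₀ : ℝ, IsWeilOnset a₀ := by
  set N : Set ℝ := {a : ℝ | 0 < a ∧ weilGroundEnergy a < 0} with hN_def
  obtain ⟨a₁, ha₁, hneg₁⟩ := exists_weilGroundEnergy_neg_of_not_riemannHypothesis h
  have hl3 : 0 < Real.log 3 / 2 := by
    have : 0 < Real.log 3 := Real.log_pos (by norm_num)
    positivity
  have hNne : N.Nonempty := ⟨a₁, hl3.trans ha₁, hneg₁⟩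
  -- every element of `N` exceeds `(log 3)/2`
  have hlb : ∀ a ∈ N, Real.log 3 / 2 < a := by
    rintro a ⟨ha, hneg⟩
    by_contra hle
    push Not at hle
    exact absurd (weilGroundEnergy_nonneg_of_le_log_three_half ha hle) (not_le.2 hneg)
  have hbdd : BddBelow N := ⟨Real.log 3 / 2, fun a ha ↦ (hlb a ha).le⟩
  set a₀ : ℝ := sInf N with ha₀_def
  have hl3a₀ : Real.log 3 / 2 ≤ a₀ := le_csInf hNne fun a ha ↦ (hlb a ha).le
  have ha₀ : 0 < a₀ := hl3.trans_le hl3a₀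
  -- (i) negative beyond `a₀`
  have hi : ∀ a, a₀ < a → weilGroundEnergy a < 0 := by
    intro a ha
    obtain ⟨b, ⟨hb, hbneg⟩, hba⟩ := exists_lt_of_csInf_lt hNne ha
    exact (weilGroundEnergy_anti hb hba.le).trans_lt hbneg
  -- (ii) non-negative before `a₀`
  have hii : ∀ a, 0 < a → a < a₀ → 0 ≤ weilGroundEnergy a := by
    intro a ha hlt
    by_contra hneg
    push Not at hneg
    exact absurd (csInf_le hbdd ⟨ha, hneg⟩) (not_le.2 hlt)
  -- (iii) continuity at `a₀` pins the value
  have hcont : ContinuousAt weilGroundEnergy a₀ := continuousAt_weilGroundEnergy ha₀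
  have hle : weilGroundEnergy a₀ ≤ 0 := by
    have ht : Tendsto weilGroundEnergy (𝓝[>] a₀) (𝓝 (weilGroundEnergy a₀)) :=
      hcont.tendsto.mono_left nhdsWithin_le_nhds
    exact le_of_tendsto ht (eventually_nhdsWithin_of_forall fun a ha ↦ (hi a ha).le)
  have hge : 0 ≤ weilGroundEnergy a₀ := by
    have ht : Tendsto weilGroundEnergy (𝓝[<] a₀) (𝓝 (weilGroundEnergy a₀)) :=
      hcont.tendsto.mono_left nhdsWithin_le_nhds
    refine ge_of_tendsto ht ?_
    rw [eventually_nhdsWithin_iff]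
    filter_upwards [lt_mem_nhds (half_lt_self ha₀)] with a ha hlt
    exact hii a (by linarith) hlt
  exact ⟨a₀, ha₀, le_antisymm hle hge, hii, hi⟩

/-- **RH fails iff an onset window exists.** [new] -/
theorem not_riemannHypothesis_iff_exists_isWeilOnset :
    ¬ RiemannHypothesis ↔ ∃ a₀ : ℝ, IsWeilOnset a₀ :=
  ⟨exists_isWeilOnset_of_not_riemannHypothesis, fun ⟨_, h⟩ ↦ h.not_riemannHypothesis⟩

/-- The same with uniqueness. [new] -/
theorem not_riemannHypothesis_iff_existsUnique_isWeilOnset :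
    ¬ RiemannHypothesis ↔ ∃! a₀ : ℝ, IsWeilOnset a₀ := by
  refine ⟨fun h ↦ ?_, fun ⟨a₀, h, _⟩ ↦ h.not_riemannHypothesis⟩
  obtain ⟨a₀, ha₀⟩ := exists_isWeilOnset_of_not_riemannHypothesis h
  exact ⟨a₀, ha₀, fun a₁ ha₁ ↦ ha₁.unique ha₀⟩

/-- **RH iff no onset.** [new] -/
theorem riemannHypothesis_iff_forall_not_isWeilOnset :
    RiemannHypothesis ↔ ∀ a₀ : ℝ, ¬ IsWeilOnset a₀ := by
  rw [← not_exists, ← not_riemannHypothesis_iff_exists_isWeilOnset, not_not]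

/-- **Sign dichotomy**: on `(0, ∞)` the ground energy is either non-negative throughout (and RH
holds) or has exactly one onset (and RH fails). [new] -/
theorem weilGroundEnergy_sign_dichotomy :
    (RiemannHypothesis ∧ ∀ a : ℝ, 0 < a → 0 ≤ weilGroundEnergy a) ∨
      (¬ RiemannHypothesis ∧ ∃! a₀ : ℝ, IsWeilOnset a₀) := by
  by_cases hRH : RiemannHypothesis
  · exact Or.inl ⟨hRH, fun a ha ↦ weilGroundEnergy_nonneg_of_riemannHypothesis hRH ha⟩
  · exact Or.inr ⟨hRH, not_riemannHypothesis_iff_existsUnique_isWeilOnset.1 hRH⟩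

/-- **RH iff zero energy is absorbing**: `ε(a) = 0 ⟹ ε(b) = 0` for all `0 < a < b`. Under RH this
is antitonicity plus `ε ≥ 0`; if RH fails it is violated at the onset. [new] -/
theorem riemannHypothesis_iff_zero_energy_absorbing :
    RiemannHypothesis ↔
      ∀ a b : ℝ, 0 < a → a < b → weilGroundEnergy a = 0 → weilGroundEnergy b = 0 := by
  constructor
  · intro hRH a b ha hab hza
    exact le_antisymm (hza ▸ weilGroundEnergy_anti ha hab.le)
      (weilGroundEnergy_nonneg_of_riemannHypothesis hRH (ha.trans hab))
  · intro H
    by_contra hRH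
    obtain ⟨a₀, h⟩ := exists_isWeilOnset_of_not_riemannHypothesis hRH
    exact (h.neg (lt_add_one a₀)).ne (H a₀ (a₀ + 1) h.pos (lt_add_one a₀) h.eq_zero)

/-- **RH iff `ε` never vanishes on a window followed by a negative one.** [new] -/
theorem riemannHypothesis_iff_no_sign_change :
    RiemannHypothesis ↔
      ∀ a b : ℝ, 0 < a → a < b → weilGroundEnergy a = 0 → 0 ≤ weilGroundEnergy b := by
  rw [riemannHypothesis_iff_zero_energy_absorbing]
  refine ⟨fun H a b ha hab hza ↦ (H a b ha hab hza).ge, fun H a b ha hab hza ↦ ?_⟩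
  exact le_antisymm (hza ▸ weilGroundEnergy_anti ha hab.le) (H a b ha hab hza)

/-- **The degenerate semi-definite window.** Under the compactness fact CCM25 Thm 3.6 (hypothesis;
it yields ground states on every window), a failure of RH produces, on the onset window `[-a₀, a₀]`,
`a₀ ≥ (log 3)/2`, an `L²`-normalised ground state `u` whose energy `ε(a₀)` is exactly `0` while the
Weil form is non-negative on every smaller window and on `[-a₀, a₀]` itself
(`Re Q(g) ≥ ε(a₀) ∫|g|² = 0`). [new] -/
theorem exists_zero_energy_groundState_of_not_riemannHypothesis
    (h36 : ConnesConsaniMoscovici2025_thm_3_6) (h : ¬ RiemannHypothesis) :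
    ∃ a₀ : ℝ, ∃ u : ℝ → ℂ, IsWeilOnset a₀ ∧ Real.log 3 / 2 ≤ a₀ ∧ IsWeilGroundState a₀ u ∧
      weilGroundEnergy a₀ = 0 ∧ WeilPositivityOn a₀ := by
  obtain ⟨a₀, ha₀⟩ := exists_isWeilOnset_of_not_riemannHypothesis h
  obtain ⟨u, hu⟩ := h36.exists_isWeilGroundState ha₀.pos
  exact ⟨a₀, u, ha₀, ha₀.log_three_half_le, hu, ha₀.eq_zero,
    (weilGroundEnergy_nonneg_iff_holds ha₀.pos).1 ha₀.eq_zero.ge⟩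


end Summit.RiemannHypothesis.RiemannHypothesis.Theorems

end
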